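import Mathlib
import Summits.MatrixMultiplication.MatrixMultiplication.Theses.HessianPlane

/-!
# Route HessianPlane — support item `MarginalsFlat` (stmt-MatrixMultiplication-8531)

For every `(a,b,c) ∈ ℂ³` the three reduced density matrices of the weighted `ℤ/3` addition table
`u(a,b,c)(x,y,z) = [x+y+z ≡ 0]·(a,b,c)_{y−x}` — the flattening along factor `1`, `2`, `3` times its
conjugate transpose — equal `(|a|²+|b|²+|c|²)·I₃`.  Every slice of the support `{x+y+z ≡ 0}` is a
permutation pattern carrying each weight `a,b,c` exactly once and distinct slices have disjoint
supports, so this is a finite computation: `ext`, `fin_cases` over the `3 × 3` entries, `simp`.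
Closes item `stmt-MatrixMultiplication-8531` of route `route-MatrixMultiplication-HessianPlane`;
no definitions, no named facts.
-/

-- the tree's namespace `Summit.MatrixMultiplication.MatrixMultiplication.…` repeats a component by design
set_option linter.dupNamespace false

namespace Summit.MatrixMultiplication.MatrixMultiplication.Theorems

open scoped BigOperators ComplexConjugate

/-- **Flat marginals on the Hessian plane** (route HessianPlane, item `MarginalsFlat`): for all
`a b c : ℂ` the three flattenings `M_i` (`i = 1,2,3`) of the tensor
`u(a,b,c)(x,y,z) = if x+y+z = 0 then ![a,b,c] (y-x) else 0` on `Fin 3 × Fin 3 × Fin 3` satisfy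
`M_i * M_iᴴ = (normSq a + normSq b + normSq c) • 1`.  Direct computation over the `27` entries.
[folklore] -/
theorem marginalsFlat_proof :
    Summit.MatrixMultiplication.MatrixMultiplication.Theses.HessianPlane.MarginalsFlat := by
  unfold Summit.MatrixMultiplication.MatrixMultiplication.Theses.HessianPlane.MarginalsFlat
  intro a b c
  refine ⟨?_, ?_, ?_⟩
  all_goals
    ext i j
    simp only [Matrix.mul_apply, Matrix.conjTranspose_apply, Matrix.of_apply,
      Fintype.sum_prod_type, Fin.sum_univ_three, Matrix.smul_apply, smul_eq_mul]
    fin_cases i <;> fin_cases j <;>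
      simp [Complex.mul_conj, add_comm, add_left_comm]

end Summit.MatrixMultiplication.MatrixMultiplication.Theorems
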